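import Summits.ValiantsHypothesis.ValiantsHypothesis.Theorems.KPlusLogSqLawTropicalBStaticFiveTriangleLaws

/-!
# `TropicalB` (stmt-ValiantsHypothesis-19771) — the static `5 × 5` cell, TRIANGLE LAW: extraction of the transfer signs and LEMMA X from a full coset

Cell `pub-symmetroid`, seat val-sym-trop-p4 (g8).  HONEST FRAMING: a finite STATIC (Birkhoff-shadow) census statement at size `5` in the currency
of `TropicalB`'s orbit (stmt-ValiantsHypothesis-19771); nothing here bears on `TropicalB` in its window, `WeakLifting`, `MatrixDescartes`
(stmt-ValiantsHypothesis-18050) or VP ≠ VNP.  Memo `HOME/val-sym-trop-p4/g8/TRIANGLE-LAW-g8.md`.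

THE TRIANGLE LAW (four files `…StaticFiveTriangleTables / …Laws / …Extract / …Triangle`): in a STATIC `5 × 5` design the three `S₂ × S₃`
cosets `σ({0,1}) = {0,1}, {0,2}, {1,2}` of dominant permutations (at most `7` each) are never simultaneously full, so at most `20` terms of a dominant
chain send the columns `0,1` into a given row triple, and by double counting over the `10` row triples a static `5 × 5` design has at most `66`
dominant terms along a chain (`static_row_five_sixtyfive`, record `69 + 1 = 70` of `StaticHalving.static_row_five`).  PROOF (memo §4): split-square law
(`ExchangeSquare.not_dominant_split_square`, p493290) inside a coset (`S = {0,1}`) and across cosets (`S` = a column pair of `{2,3,4}`), EDGE RULE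
(diagonal bracketing `Bracketing.slope_bracket_split`, p522470), slope LATIN identity + parity-class law (p522470) = LEMMA X
(`StaticFiveTriangle.coset_core_*`, p542783), sign chain `StaticFiveTriangle.triangle_core` through the common block exchanges of rows `3, 4`.
The `36` permutations of the family are `perm36 i l u` (coset `i : Fin 3` = rows `(0,1),(0,2),(1,2)` on columns `0,1`; left `l : Fin 2`, `l = 0` =
smaller row at column `0`; right `u : Fin 6` = the bijection columns `(2,3,4) → (y,3,4)` composed with the `u`-th element of `S₃` in the order
`id, (120), (201), (021), (210), (102)` — `0,1,2` even, `3,4,5` odd, pairs `{u, u+3}` = positions `34, 23, 24`).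

THIS FILE: `coset_extract`: a full one-dbl coset (pivot `k`, pure elsewhere, no left-sharing pair away from the pivot's position) satisfies the transfer inequalities `0 < σ · t_q · B_q` at its two non-pivot positions and LEMMA X in `t`-form (via `coset_core_34 / _23 / _24` of p542783 with `x u := σ · cellR u`).
[this seat]
-/

set_option linter.dupNamespace false
set_option autoImplicit false

namespace Summit.ValiantsHypothesis.ValiantsHypothesis.Theorems.KPlusLogSqLaw.StaticFiveTriangle

open Summit.ValiantsHypothesis.ValiantsHypothesis.Theorems.MatrixDescartes.Negative
open Summit.ValiantsHypothesis.ValiantsHypothesis.Theorems.LacunarySymmetroidMatrixDescartes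
open Summit.ValiantsHypothesis.ValiantsHypothesis.Theorems.LacunarySymmetroidMatrixDescartes.TropicalCensus
open Finset

/-! ### 7. Extraction: a full one-dbl coset yields its transfer signs and LEMMA X in `t`-form -/

section Extract

variable {K : ℕ} (d : Fin K → ℕ) (v : Fin 5 → Fin 5 → Fin K → ℤ) {ε : Fin 5 → Fin 5 → Fin K → ℤ} {cls : Fin 5 → Fin 5 → Fin K}
variable {n : ℕ} {θ : Fin (n + 1) → ℤ} {p : Fin (n + 1) → Equiv.Perm (Fin 5) × (Fin 5 → Fin K)}

/-- dividing an inequality by a positive factor. -/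
theorem le_of_pos_mul {σ a b : ℤ} (hσ : 0 < σ) (h : σ * a ≤ σ * b) : a ≤ b := by
  by_contra hc; have hc' := lt_of_not_ge hc; nlinarith

/-- dividing an inequality by a negative factor. -/
theorem le_of_neg_mul {σ a b : ℤ} (hσ : σ < 0) (h : σ * a ≤ σ * b) : b ≤ a := by
  by_contra hc; have hc' := lt_of_not_ge hc; nlinarith

/-- **EXTRACTION.**  For a coset `i` whose occurring `(left, right)` pairs `T` form a full one-dbl pattern with pivot `k` — both lefts at `k`,
exactly one left at every other right, and no common left on the two pairs away from the pivot's position — the transfer inequalities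
`0 < σ · t_q · B_q` hold at the two non-pivot positions and LEMMA X relates the two `t`'s (`σ` = left orientation, `B_q` = common block
exchange of rows `3,4`). -/
theorem coset_extract (hs : IsStatic ε) (hcls : ∀ r c k, ε r c k ≠ 0 → ε r c (cls r c) ≠ 0)
    (hθ : StrictMono θ) (hdom : ∀ k, IsDominant d v ε (θ k) (p k))
    (i : Fin 3) (T : Finset (Fin 2 × Fin 6)) (hT : ∀ l u, (l, u) ∈ T → (∃ k, (p k).1 = perm36 i l u))
    (k : Fin 6) (hk : (0, k) ∈ T ∧ (1, k) ∈ T)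
    (hpure : ∀ u : Fin 6, u ≠ k → (((0, u) ∈ T ∧ (1, u) ∉ T) ∨ ((0, u) ∉ T ∧ (1, u) ∈ T)))
    (hsep : ∀ q : Fin 3, q.val ≠ k.val % 3 → ¬((0, evn q) ∈ T ∧ (0, prt q) ∈ T) ∧ ¬((1, evn q) ∈ T ∧ (1, prt q) ∈ T)) :
    let σ := cellL (aOf d cls) i 1 - cellL (aOf d cls) i 0
    (∀ q : Fin 3, q.val ≠ k.val % 3 → 0 < σ * tsgn T q * Bq (aOf d cls) q) ∧
    (k.val % 3 = 0 → tsgn T 2 = tsgn T 1) ∧ (k.val % 3 = 1 → tsgn T 2 = tsgn T 0) ∧ (k.val % 3 = 2 → tsgn T 0 = -tsgn T 1) := by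
  intro σ
  set a := aOf d cls with ha
  -- orientation is nonzero: the pivot's two terms are different dominant terms, hence have different slopes
  have hσ : σ ≠ 0 := by
    obtain ⟨k₀, d₀⟩ := dom_of_W d v hs hcls hdom (hT 0 k hk.1)
    obtain ⟨k₁, d₁⟩ := dom_of_W d v hs hcls hdom (hT 1 k hk.2)
    have hne : lterm cls i 0 k ≠ lterm cls i 1 k := lterm_ne cls (by simp)
    have s0 := slope_lterm d cls i 0 k
    have s1 := slope_lterm d cls i 1 k
    intro h0
    rcases lt_or_gt_of_ne (θ_ne_of_dom d v hne d₀ d₁) with h | h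
    · have := TropicalCensus.slope_lt_of_dominant d v ε h hne d₀ d₁
      rw [s0, s1] at this; simp only [σ] at h0; linarith
    · have := TropicalCensus.slope_lt_of_dominant d v ε h hne.symm d₁ d₀
      rw [s0, s1] at this; simp only [σ] at h0; linarith
  -- the EDGE rule in `T`-language
  have hedge : ∀ u u' : Fin 6, u ≠ u' → (0, u) ∈ T → (1, u') ∈ T → σ * cellR a i u < σ * cellR a i u' := by
    intro u u' huu h0 h1
    have := edge d v hs hcls hθ hdom huu (hT 0 u h0) (hT 1 u' h1)
    rw [← ha] at this
    have : 0 < σ * (cellR a i u' - cellR a i u) := this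
    linarith [mul_sub σ (cellR a i u') (cellR a i u)]
  -- transfer inequalities at separated positions
  have htrans : ∀ q : Fin 3, q.val ≠ k.val % 3 → 0 < σ * tsgn T q * Bq a q := by
    intro q hq
    have hk1 : evn q ≠ k := by intro h; apply hq; rw [← h]; simp [evn]; omega
    have hk2 : prt q ≠ k := by intro h; apply hq; rw [← h]; simp [prt]; omega
    have pair := cellR_pair a i q
    obtain ⟨ns0, ns1⟩ := hsep q hq
    rcases hpure (evn q) hk1 with ⟨e0, e1⟩ | ⟨e0, e1⟩ <;> rcases hpure (prt q) hk2 with ⟨f0, f1⟩ | ⟨f0, f1⟩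
    · exact absurd ⟨e0, f0⟩ ns0
    · -- even carries left 0, partner carries left 1: edge evn → prt
      have h := hedge (evn q) (prt q) (by simp [evn, prt, Fin.ext_iff]) e0 f1
      have e2 : 0 < σ * (cellR a i (prt q) - cellR a i (evn q)) := by rw [mul_sub]; linarith
      have e3 : σ * -κ q * Bq a q = σ * (cellR a i (prt q) - cellR a i (evn q)) := by linear_combination σ * pair
      simp only [tsgn, f0, if_false]
      linarith
    · -- partner carries left 0, even carries left 1: edge prt → evn
      have h := hedge (prt q) (evn q) (by simp [evn, prt, Fin.ext_iff]) f0 e1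
      have e2 : 0 < σ * (cellR a i (evn q) - cellR a i (prt q)) := by rw [mul_sub]; linarith
      have e3 : σ * κ q * Bq a q = σ * (cellR a i (evn q) - cellR a i (prt q)) := by linear_combination -σ * pair
      simp only [tsgn, f0, if_true]
      linarith
    · exact absurd ⟨e1, f1⟩ ns1
  refine ⟨htrans, ?_, ?_, ?_⟩
  all_goals intro hkm
  -- LEMMA X via the abstract core, with `x u := σ · cellR u`, `h1/h2` = membership of `(0,u)/(1,u)`
  all_goals
    have hsum : σ * cellR a i 0 + σ * cellR a i 1 + σ * cellR a i 2 = σ * cellR a i 3 + σ * cellR a i 4 + σ * cellR a i 5 := by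
      have := cellR_latin a i; linear_combination σ * this
    have edge' : ∀ u u' : Fin 6, u ≠ u' → decide ((0, u) ∈ T) = true → decide ((1, u') ∈ T) = true →
        σ * cellR a i u < σ * cellR a i u' := fun u u' huu h0 h1 =>
      hedge u u' huu (of_decide_eq_true h0) (of_decide_eq_true h1)
    have lawE : ∀ L : Fin 6 → Bool, (L = (fun u => decide ((0, u) ∈ T)) ∨ L = (fun u => decide ((1, u) ∈ T))) →
        L 0 = true → L 1 = true → L 2 = true → ∀ o o' : Fin 6, (o = 3 ∨ o = 4 ∨ o = 5) → (o' = 3 ∨ o' = 4 ∨ o' = 5) →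
        σ * cellR a i o ≤ σ * cellR a i 0 → σ * cellR a i o ≤ σ * cellR a i 1 → σ * cellR a i o ≤ σ * cellR a i 2 →
        σ * cellR a i 0 ≤ σ * cellR a i o' → σ * cellR a i 1 ≤ σ * cellR a i o' → σ * cellR a i 2 ≤ σ * cellR a i o' → False := by
      intro L hL L0 L1 L2 o o' ho ho' c0 c1 c2 c3 c4 c5
      obtain ⟨l, w0, w1, w2⟩ : ∃ l : Fin 2, (∃ k, (p k).1 = perm36 i l 0) ∧ (∃ k, (p k).1 = perm36 i l 1) ∧ (∃ k, (p k).1 = perm36 i l 2) := by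
        rcases hL with rfl | rfl
        · exact ⟨0, hT 0 0 (of_decide_eq_true L0), hT 0 1 (of_decide_eq_true L1), hT 0 2 (of_decide_eq_true L2)⟩
        · exact ⟨1, hT 1 0 (of_decide_eq_true L0), hT 1 1 (of_decide_eq_true L1), hT 1 2 (of_decide_eq_true L2)⟩
      rcases lt_or_gt_of_ne hσ with hn | hp
      · exact law_even d v hs hcls hdom w0 w1 w2 ho' ho
          ⟨le_of_neg_mul hn c3, le_of_neg_mul hn c4, le_of_neg_mul hn c5⟩ ⟨le_of_neg_mul hn c0, le_of_neg_mul hn c1, le_of_neg_mul hn c2⟩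
      · exact law_even d v hs hcls hdom w0 w1 w2 ho ho'
          ⟨le_of_pos_mul hp c0, le_of_pos_mul hp c1, le_of_pos_mul hp c2⟩ ⟨le_of_pos_mul hp c3, le_of_pos_mul hp c4, le_of_pos_mul hp c5⟩
    have lawO : ∀ L : Fin 6 → Bool, (L = (fun u => decide ((0, u) ∈ T)) ∨ L = (fun u => decide ((1, u) ∈ T))) →
        L 3 = true → L 4 = true → L 5 = true → ∀ e e' : Fin 6, (e = 0 ∨ e = 1 ∨ e = 2) → (e' = 0 ∨ e' = 1 ∨ e' = 2) →
        σ * cellR a i e ≤ σ * cellR a i 3 → σ * cellR a i e ≤ σ * cellR a i 4 → σ * cellR a i e ≤ σ * cellR a i 5 →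
        σ * cellR a i 3 ≤ σ * cellR a i e' → σ * cellR a i 4 ≤ σ * cellR a i e' → σ * cellR a i 5 ≤ σ * cellR a i e' → False := by
      intro L hL L3 L4 L5 e e' he he' c0 c1 c2 c3 c4 c5
      obtain ⟨l, w3, w4, w5⟩ : ∃ l : Fin 2, (∃ k, (p k).1 = perm36 i l 3) ∧ (∃ k, (p k).1 = perm36 i l 4) ∧ (∃ k, (p k).1 = perm36 i l 5) := by
        rcases hL with rfl | rfl
        · exact ⟨0, hT 0 3 (of_decide_eq_true L3), hT 0 4 (of_decide_eq_true L4), hT 0 5 (of_decide_eq_true L5)⟩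
        · exact ⟨1, hT 1 3 (of_decide_eq_true L3), hT 1 4 (of_decide_eq_true L4), hT 1 5 (of_decide_eq_true L5)⟩
      rcases lt_or_gt_of_ne hσ with hn | hp
      · exact law_odd d v hs hcls hdom w3 w4 w5 he' he
          ⟨le_of_neg_mul hn c3, le_of_neg_mul hn c4, le_of_neg_mul hn c5⟩ ⟨le_of_neg_mul hn c0, le_of_neg_mul hn c1, le_of_neg_mul hn c2⟩
      · exact law_odd d v hs hcls hdom w3 w4 w5 he he'
          ⟨le_of_pos_mul hp c0, le_of_pos_mul hp c1, le_of_pos_mul hp c2⟩ ⟨le_of_pos_mul hp c3, le_of_pos_mul hp c4, le_of_pos_mul hp c5⟩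
    -- membership literals as Boolean facts
    have tt : ∀ {l : Fin 2} {u : Fin 6}, (l, u) ∈ T → decide ((l, u) ∈ T) = true := fun h => decide_eq_true h
    have ff : ∀ {l : Fin 2} {u : Fin 6}, (l, u) ∉ T → decide ((l, u) ∈ T) = false := fun h => decide_eq_false h
  -- position 34 (pivot `k ∈ {0, 3}`): evens `1, 2` differ, i.e. `t 2 = t 1`
  · have hk03 : k = 0 ∨ k = 3 := by
      have := k.isLt; rcases k with ⟨k, _⟩; simp only [Fin.ext_iff, Fin.val_zero]; simp only at hkm; omega
    obtain ⟨sA0, sA1⟩ := hsep 1 (by omega)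
    obtain ⟨sB0, sB1⟩ := hsep 2 (by omega)
    have n1 : (1 : Fin 6) ≠ k := by rcases hk03 with rfl | rfl <;> decide
    have n4 : (4 : Fin 6) ≠ k := by rcases hk03 with rfl | rfl <;> decide
    have n2 : (2 : Fin 6) ≠ k := by rcases hk03 with rfl | rfl <;> decide
    have n5 : (5 : Fin 6) ≠ k := by rcases hk03 with rfl | rfl <;> decide
    -- the pairs away from the pivot are strictly separated
    have hA : (decide ((0, (1 : Fin 6)) ∈ T) = true ∧ decide ((1, (1 : Fin 6)) ∈ T) = false ∧
        decide ((0, (4 : Fin 6)) ∈ T) = false ∧ decide ((1, (4 : Fin 6)) ∈ T) = true) ∨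
        (decide ((0, (1 : Fin 6)) ∈ T) = false ∧ decide ((1, (1 : Fin 6)) ∈ T) = true ∧
        decide ((0, (4 : Fin 6)) ∈ T) = true ∧ decide ((1, (4 : Fin 6)) ∈ T) = false) := by
      rcases hpure 1 n1 with ⟨a0, a1⟩ | ⟨a0, a1⟩ <;> rcases hpure 4 n4 with ⟨b0, b1⟩ | ⟨b0, b1⟩
      · exact absurd ⟨a0, b0⟩ sA0
      · exact Or.inl ⟨tt a0, ff a1, ff b0, tt b1⟩
      · exact Or.inr ⟨ff a0, tt a1, tt b0, ff b1⟩
      · exact absurd ⟨a1, b1⟩ sA1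
    have hB : (decide ((0, (2 : Fin 6)) ∈ T) = true ∧ decide ((1, (2 : Fin 6)) ∈ T) = false ∧
        decide ((0, (5 : Fin 6)) ∈ T) = false ∧ decide ((1, (5 : Fin 6)) ∈ T) = true) ∨
        (decide ((0, (2 : Fin 6)) ∈ T) = false ∧ decide ((1, (2 : Fin 6)) ∈ T) = true ∧
        decide ((0, (5 : Fin 6)) ∈ T) = true ∧ decide ((1, (5 : Fin 6)) ∈ T) = false) := by
      rcases hpure 2 n2 with ⟨a0, a1⟩ | ⟨a0, a1⟩ <;> rcases hpure 5 n5 with ⟨b0, b1⟩ | ⟨b0, b1⟩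
      · exact absurd ⟨a0, b0⟩ sB0
      · exact Or.inl ⟨tt a0, ff a1, ff b0, tt b1⟩
      · exact Or.inr ⟨ff a0, tt a1, tt b0, ff b1⟩
      · exact absurd ⟨a1, b1⟩ sB1
    have hpiv : (decide ((0, (0 : Fin 6)) ∈ T) = true ∧ decide ((1, (0 : Fin 6)) ∈ T) = true ∧
        ((decide ((0, (3 : Fin 6)) ∈ T) = true ∧ decide ((1, (3 : Fin 6)) ∈ T) = false) ∨
         (decide ((0, (3 : Fin 6)) ∈ T) = false ∧ decide ((1, (3 : Fin 6)) ∈ T) = true))) ∨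
        (decide ((0, (3 : Fin 6)) ∈ T) = true ∧ decide ((1, (3 : Fin 6)) ∈ T) = true ∧
        ((decide ((0, (0 : Fin 6)) ∈ T) = true ∧ decide ((1, (0 : Fin 6)) ∈ T) = false) ∨
         (decide ((0, (0 : Fin 6)) ∈ T) = false ∧ decide ((1, (0 : Fin 6)) ∈ T) = true))) := by
      rcases hk03 with rfl | rfl
      · left; refine ⟨tt hk.1, tt hk.2, ?_⟩
        rcases hpure 3 (by decide) with ⟨a0, a1⟩ | ⟨a0, a1⟩
        exacts [Or.inl ⟨tt a0, ff a1⟩, Or.inr ⟨ff a0, tt a1⟩]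
      · right; refine ⟨tt hk.1, tt hk.2, ?_⟩
        rcases hpure 0 (by decide) with ⟨a0, a1⟩ | ⟨a0, a1⟩
        exacts [Or.inl ⟨tt a0, ff a1⟩, Or.inr ⟨ff a0, tt a1⟩]
    -- LEMMA X: the evens 1, 2 carry different lefts
    have hX : decide ((0, (1 : Fin 6)) ∈ T) ≠ decide ((0, (2 : Fin 6)) ∈ T) := fun hbad =>
      coset_core_34 (fun u => σ * cellR a i u) (fun u => decide ((0, u) ∈ T)) (fun u => decide ((1, u) ∈ T))
        hsum edge' lawE lawO hpiv hA hB hbad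
    -- translate into `t 2 = t 1`
    have p1 : prt 1 = 4 := rfl
    have p2 : prt 2 = 5 := rfl
    simp only [tsgn, p1, p2]
    rcases hA with ⟨a0, -, a4, -⟩ | ⟨a0, -, a4, -⟩ <;> rcases hB with ⟨b0, -, b5, -⟩ | ⟨b0, -, b5, -⟩
    · exact absurd (a0.trans b0.symm) hX
    · rw [if_neg (of_decide_eq_false a4), if_pos (of_decide_eq_true b5)]; simp [κ]
    · rw [if_pos (of_decide_eq_true a4), if_neg (of_decide_eq_false b5)]; simp [κ]
    · exact absurd (a0.trans b0.symm) hX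
  -- position 23 (pivot `k ∈ {1, 4}`): evens `0, 2` differ, i.e. `t 2 = t 0`
  · have hk14 : k = 1 ∨ k = 4 := by
      have := k.isLt; rcases k with ⟨k, _⟩; simp only [Fin.ext_iff]; simp only at hkm ⊢; omega
    obtain ⟨sA0, sA1⟩ := hsep 0 (by omega)
    obtain ⟨sB0, sB1⟩ := hsep 2 (by omega)
    have n0 : (0 : Fin 6) ≠ k := by rcases hk14 with rfl | rfl <;> decide
    have n3 : (3 : Fin 6) ≠ k := by rcases hk14 with rfl | rfl <;> decide
    have n2 : (2 : Fin 6) ≠ k := by rcases hk14 with rfl | rfl <;> decide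
    have n5 : (5 : Fin 6) ≠ k := by rcases hk14 with rfl | rfl <;> decide
    have hA : (decide ((0, (0 : Fin 6)) ∈ T) = true ∧ decide ((1, (0 : Fin 6)) ∈ T) = false ∧
        decide ((0, (3 : Fin 6)) ∈ T) = false ∧ decide ((1, (3 : Fin 6)) ∈ T) = true) ∨
        (decide ((0, (0 : Fin 6)) ∈ T) = false ∧ decide ((1, (0 : Fin 6)) ∈ T) = true ∧
        decide ((0, (3 : Fin 6)) ∈ T) = true ∧ decide ((1, (3 : Fin 6)) ∈ T) = false) := by
      rcases hpure 0 n0 with ⟨a0, a1⟩ | ⟨a0, a1⟩ <;> rcases hpure 3 n3 with ⟨b0, b1⟩ | ⟨b0, b1⟩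
      · exact absurd ⟨a0, b0⟩ sA0
      · exact Or.inl ⟨tt a0, ff a1, ff b0, tt b1⟩
      · exact Or.inr ⟨ff a0, tt a1, tt b0, ff b1⟩
      · exact absurd ⟨a1, b1⟩ sA1
    have hB : (decide ((0, (2 : Fin 6)) ∈ T) = true ∧ decide ((1, (2 : Fin 6)) ∈ T) = false ∧
        decide ((0, (5 : Fin 6)) ∈ T) = false ∧ decide ((1, (5 : Fin 6)) ∈ T) = true) ∨
        (decide ((0, (2 : Fin 6)) ∈ T) = false ∧ decide ((1, (2 : Fin 6)) ∈ T) = true ∧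
        decide ((0, (5 : Fin 6)) ∈ T) = true ∧ decide ((1, (5 : Fin 6)) ∈ T) = false) := by
      rcases hpure 2 n2 with ⟨a0, a1⟩ | ⟨a0, a1⟩ <;> rcases hpure 5 n5 with ⟨b0, b1⟩ | ⟨b0, b1⟩
      · exact absurd ⟨a0, b0⟩ sB0
      · exact Or.inl ⟨tt a0, ff a1, ff b0, tt b1⟩
      · exact Or.inr ⟨ff a0, tt a1, tt b0, ff b1⟩
      · exact absurd ⟨a1, b1⟩ sB1
    have hpiv : (decide ((0, (1 : Fin 6)) ∈ T) = true ∧ decide ((1, (1 : Fin 6)) ∈ T) = true ∧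
        ((decide ((0, (4 : Fin 6)) ∈ T) = true ∧ decide ((1, (4 : Fin 6)) ∈ T) = false) ∨
         (decide ((0, (4 : Fin 6)) ∈ T) = false ∧ decide ((1, (4 : Fin 6)) ∈ T) = true))) ∨
        (decide ((0, (4 : Fin 6)) ∈ T) = true ∧ decide ((1, (4 : Fin 6)) ∈ T) = true ∧
        ((decide ((0, (1 : Fin 6)) ∈ T) = true ∧ decide ((1, (1 : Fin 6)) ∈ T) = false) ∨
         (decide ((0, (1 : Fin 6)) ∈ T) = false ∧ decide ((1, (1 : Fin 6)) ∈ T) = true))) := by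
      rcases hk14 with rfl | rfl
      · left; refine ⟨tt hk.1, tt hk.2, ?_⟩
        rcases hpure 4 (by decide) with ⟨a0, a1⟩ | ⟨a0, a1⟩
        exacts [Or.inl ⟨tt a0, ff a1⟩, Or.inr ⟨ff a0, tt a1⟩]
      · right; refine ⟨tt hk.1, tt hk.2, ?_⟩
        rcases hpure 1 (by decide) with ⟨a0, a1⟩ | ⟨a0, a1⟩
        exacts [Or.inl ⟨tt a0, ff a1⟩, Or.inr ⟨ff a0, tt a1⟩]
    have hX : decide ((0, (0 : Fin 6)) ∈ T) ≠ decide ((0, (2 : Fin 6)) ∈ T) := fun hbad =>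
      coset_core_23 (fun u => σ * cellR a i u) (fun u => decide ((0, u) ∈ T)) (fun u => decide ((1, u) ∈ T))
        hsum edge' lawE lawO hpiv hA hB hbad
    have p0 : prt 0 = 3 := rfl
    have p2 : prt 2 = 5 := rfl
    simp only [tsgn, p0, p2]
    rcases hA with ⟨a0, -, a3, -⟩ | ⟨a0, -, a3, -⟩ <;> rcases hB with ⟨b0, -, b5, -⟩ | ⟨b0, -, b5, -⟩
    · exact absurd (a0.trans b0.symm) hX
    · rw [if_neg (of_decide_eq_false a3), if_pos (of_decide_eq_true b5)]; simp [κ]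
    · rw [if_pos (of_decide_eq_true a3), if_neg (of_decide_eq_false b5)]; simp [κ]
    · exact absurd (a0.trans b0.symm) hX
  -- position 24 (pivot `k ∈ {2, 5}`): evens `0, 1` differ, i.e. `t 0 = −t 1`
  · have hk25 : k = 2 ∨ k = 5 := by
      have := k.isLt; rcases k with ⟨k, _⟩; simp only [Fin.ext_iff]; simp only at hkm ⊢; omega
    obtain ⟨sA0, sA1⟩ := hsep 0 (by omega)
    obtain ⟨sB0, sB1⟩ := hsep 1 (by omega)
    have n0 : (0 : Fin 6) ≠ k := by rcases hk25 with rfl | rfl <;> decide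
    have n3 : (3 : Fin 6) ≠ k := by rcases hk25 with rfl | rfl <;> decide
    have n1 : (1 : Fin 6) ≠ k := by rcases hk25 with rfl | rfl <;> decide
    have n4 : (4 : Fin 6) ≠ k := by rcases hk25 with rfl | rfl <;> decide
    have hA : (decide ((0, (0 : Fin 6)) ∈ T) = true ∧ decide ((1, (0 : Fin 6)) ∈ T) = false ∧
        decide ((0, (3 : Fin 6)) ∈ T) = false ∧ decide ((1, (3 : Fin 6)) ∈ T) = true) ∨
        (decide ((0, (0 : Fin 6)) ∈ T) = false ∧ decide ((1, (0 : Fin 6)) ∈ T) = true ∧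
        decide ((0, (3 : Fin 6)) ∈ T) = true ∧ decide ((1, (3 : Fin 6)) ∈ T) = false) := by
      rcases hpure 0 n0 with ⟨a0, a1⟩ | ⟨a0, a1⟩ <;> rcases hpure 3 n3 with ⟨b0, b1⟩ | ⟨b0, b1⟩
      · exact absurd ⟨a0, b0⟩ sA0
      · exact Or.inl ⟨tt a0, ff a1, ff b0, tt b1⟩
      · exact Or.inr ⟨ff a0, tt a1, tt b0, ff b1⟩
      · exact absurd ⟨a1, b1⟩ sA1
    have hB : (decide ((0, (1 : Fin 6)) ∈ T) = true ∧ decide ((1, (1 : Fin 6)) ∈ T) = false ∧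
        decide ((0, (4 : Fin 6)) ∈ T) = false ∧ decide ((1, (4 : Fin 6)) ∈ T) = true) ∨
        (decide ((0, (1 : Fin 6)) ∈ T) = false ∧ decide ((1, (1 : Fin 6)) ∈ T) = true ∧
        decide ((0, (4 : Fin 6)) ∈ T) = true ∧ decide ((1, (4 : Fin 6)) ∈ T) = false) := by
      rcases hpure 1 n1 with ⟨a0, a1⟩ | ⟨a0, a1⟩ <;> rcases hpure 4 n4 with ⟨b0, b1⟩ | ⟨b0, b1⟩
      · exact absurd ⟨a0, b0⟩ sB0
      · exact Or.inl ⟨tt a0, ff a1, ff b0, tt b1⟩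
      · exact Or.inr ⟨ff a0, tt a1, tt b0, ff b1⟩
      · exact absurd ⟨a1, b1⟩ sB1
    have hpiv : (decide ((0, (2 : Fin 6)) ∈ T) = true ∧ decide ((1, (2 : Fin 6)) ∈ T) = true ∧
        ((decide ((0, (5 : Fin 6)) ∈ T) = true ∧ decide ((1, (5 : Fin 6)) ∈ T) = false) ∨
         (decide ((0, (5 : Fin 6)) ∈ T) = false ∧ decide ((1, (5 : Fin 6)) ∈ T) = true))) ∨
        (decide ((0, (5 : Fin 6)) ∈ T) = true ∧ decide ((1, (5 : Fin 6)) ∈ T) = true ∧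
        ((decide ((0, (2 : Fin 6)) ∈ T) = true ∧ decide ((1, (2 : Fin 6)) ∈ T) = false) ∨
         (decide ((0, (2 : Fin 6)) ∈ T) = false ∧ decide ((1, (2 : Fin 6)) ∈ T) = true))) := by
      rcases hk25 with rfl | rfl
      · left; refine ⟨tt hk.1, tt hk.2, ?_⟩
        rcases hpure 5 (by decide) with ⟨a0, a1⟩ | ⟨a0, a1⟩
        exacts [Or.inl ⟨tt a0, ff a1⟩, Or.inr ⟨ff a0, tt a1⟩]
      · right; refine ⟨tt hk.1, tt hk.2, ?_⟩
        rcases hpure 2 (by decide) with ⟨a0, a1⟩ | ⟨a0, a1⟩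
        exacts [Or.inl ⟨tt a0, ff a1⟩, Or.inr ⟨ff a0, tt a1⟩]
    have hX : decide ((0, (0 : Fin 6)) ∈ T) ≠ decide ((0, (1 : Fin 6)) ∈ T) := fun hbad =>
      coset_core_24 (fun u => σ * cellR a i u) (fun u => decide ((0, u) ∈ T)) (fun u => decide ((1, u) ∈ T))
        hsum edge' lawE lawO hpiv hA hB hbad
    have p0 : prt 0 = 3 := rfl
    have p1 : prt 1 = 4 := rfl
    simp only [tsgn, p0, p1]
    rcases hA with ⟨a0, -, a3, -⟩ | ⟨a0, -, a3, -⟩ <;> rcases hB with ⟨b0, -, b4, -⟩ | ⟨b0, -, b4, -⟩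
    · exact absurd (a0.trans b0.symm) hX
    · rw [if_neg (of_decide_eq_false a3), if_pos (of_decide_eq_true b4)]; simp [κ]
    · rw [if_pos (of_decide_eq_true a3), if_neg (of_decide_eq_false b4)]; simp [κ]
    · exact absurd (a0.trans b0.symm) hX

end Extract



end Summit.ValiantsHypothesis.ValiantsHypothesis.Theorems.KPlusLogSqLaw.StaticFiveTriangle
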